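import Mathlib
import HarnessLib
import HarnessLib.Audit
import Summits.AtomisticToContinuum.Statement
import Literature.MathematicalPhysics.KineticTheory.NewtonianFlow

/-!
Route: KacRangeDichotomy

CLOSED (retired) 2026-08-15T13:43:27Z by operator:999:1257524 — reason: not-a-thesis: assembly does not conclude the sub-problem Statement — note: D-0027 §2.1 audit (human 2026-08-15: routes that do not decide the summit are removed): the assembly concludes `PhononThresholdLaw`, not the sub-problem statement; a NEW conforming route may be opened from the same idea (generated `closes : … → _root_.FouriersLaw`).. The file is kept as the record of this route; refuted decls are indexed as negative knowledge (`ledger negatives`).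

# Route KacRangeDichotomy — Kac-range corner with its threshold: below T*(κ) the dressed phonon sits
in the spectral gap of the lattice-Vlasov linearisation (undamped), above it Landau damping and
Lenard–Balescu cooling

RUNG ROUTE — a window result on a deformed family; NO assembly to FouriersLaw is claimed (R = 1 is
reached only through an engine-less bet, as the card itself says). Realises idea card
kac-range-vlasov-landau-damping WITH A CORRECTION found while planning. Deform pinnedChain by a Kac
range R: H_R = Σ_x [p_x²/2 + U(q_x)] + ½ Σ_{x≠y} R⁻¹φ((x−y)/R) V(q_x − q_y) (φ ≥ 0 even, C², compact
support, φ(±1) = 1 and φ = 0 at the integers |z| ≥ 2, so that R = 1 is exactly pinnedChain ω₂ lam β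
γ), N = LR sites, the two Langevin baths at the ends. At R = ∞ (lattice Vlasov equation, frozen
labels u = x/R) the linearisation around the thermal state at macroscopic wavenumber κ is free
transport in the effective one-body well h = p²/2 + Aq²/2 + Bq⁴/4 (β = 0 sector: A = ω₂ + Φ₀, B =
lam, Φ₀ = ∫φ) fed back through the dipole moment with strength s = φ̂(κ) ∈ (0, Φ₀] ⊂ (0, A): m(t) =
S(t) + s ∫₀ᵗ K_T(t−τ) m(τ) dτ with K_T = −C_T′/T, C_T(t) = ⟨q(0) q(t)⟩_T (harmonic check B = 0: K =
sin(√A t)/√A, root ω² = A − s = the Kac phonon). X (typed) = PhononThresholdLaw = X_gap ∧ X_emb: for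
all A, B > 0 and s ∈ (0, A) the dispersion relation 1 = s K̂_T(iω) has a real root ω in the one-body
spectral GAP (0, √A) at some temperature — GapPhononBranch: at every small T, an undamped dressed
phonon (no oscillator is resonant with it, so nothing can Landau-damp it) — and at no large
temperature — EmbeddedRegimeDamping: at large T the branch has entered the continuum [√A, ∞) and the
dipole sector Landau-damps (every Volterra solution with a decaying source decays). X (informal,
filed as items right after open, signatures pending two definition requests) = the card's
model-level ladder read through this dichotomy: LatticeVlasovLimit (V0), TwoChannelKineticLimit
(order 1/R: inhomogeneous Lenard–Balescu for the one-body continuum ⊕ a wave-kinetic equation for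
the gap phonons — the Rogister–Oberman completion; Lenard–Balescu alone, i.e. the card's nonlocal
Newton cooling, only in the embedded regime), KacConductivityScaling (κ_latt(R) ≍ R·κ_LB above
threshold, ≍ R²·κ_ph below: the harmonic ballistic ghost survives twist at Vlasov order as a fast,
weakly damped phonon channel).
Lean: `Summit.AtomisticToContinuum.FouriersLaw.Theses.KacRangeDichotomy.GapPhononBranch →
Summit.AtomisticToContinuum.FouriersLaw.Theses.KacRangeDichotomy.EmbeddedRegimeDamping →
Summit.AtomisticToContinuum.FouriersLaw.Theses.KacRangeDichotomy.PhononThresholdLaw`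

## Assembly
Real-analysis glue (about a hundred lines, provable once the cruxes close): fix A, B, Φ, s. Clause
(i) of the target is GapPhononBranch at T = T₀/2. Clause (ii): take T₁ from EmbeddedRegimeDamping;
if some T > T₁ had a gap root ω, put m(t) := cos ωt and S(t) := cos ωt − s∫₀ᵗ K_T(t − τ) cos ωτ dτ,
so that m = S + s K_T ∗ m on t ≥ 0 by construction; S is continuous (K_T locally integrable,
dominated convergence) and, expanding cos ω(t − u) and letting t → ∞ with K_T ∈ L¹, S(t) = cos ωt·(1
− s∫₀ᵗ K_T cos ωu du) + sin ωt·(s∫₀ᵗ K_T sin ωu du) → 0 by the two root identities; the crux then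
forces cos ωt → 0, absurd. The supports DuffingTwist / DuffingFlow are inputs of the crux proofs,
not of the glue. Nothing composes to FouriersLaw: the informal items (Vlasov limit, kinetic level,
conductivity scaling) sit above X on the Kac family and R = 1 stays a bet.

Rationale: WHY THIS LINE. The card's ladder (mean-field limit → Landau damping as the theorem-form of thermal
dephasing → Lenard–Balescu ⇒ nonlocal Newton cooling ⇒ Fourier at O(1/R)) imports plasma kinetic
theory with an explicit dictionary (labelled lattice Vlasov equations BachelardEtAl2011,
CampaEtAl2014 §8; non-exchangeable mean-field limits arXiv:2112.15406, Duerinckx2021; Landau damping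
FaouRousset2015, BarreOlivettiYamaguchi2011; Lenard–Balescu DuerinckxSaintraymond2021 with the
angle–action kernel of Heyvaerts2010, Chavanis2012). Planning exposed the decisive one-body
computation the card skipped: oscillators do not stream, so every equilibrium is 'inhomogeneous' in
the plasma sense; the m = 1 band of one-body frequencies of the hardening well is [√A, ∞)
(DuffingTwist), the bare Kac phonon ω(κ)² = A − φ̂(κ) lies BELOW it, and the thermal dipole
susceptibility stays FINITE at the band edge because the spectral weight |q₁(I)|² ≈ I/(2√A) vanishes
linearly there (χ_T(√A⁻) ≈ 2A/(3BT) as BT/A² → 0) — so whenever φ̂(κ)·χ_T(edge) > 1, i.e. for all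
long waves at low temperature, the dressed phonon is a discrete real eigenvalue in the gap, undamped
at Vlasov order (the mechanism of the discrete modes of 1-D collisionless systems Louis1992, of the
water-bag zeros of the dielectric function CampaEtAl2014 §9.2, of the discrete spectrum of strong
long-range systems Defenu2021), while above the threshold it is embedded and Landau-damped. This
turns the card's V1 ('damping as soon as lam > 0 or β > 0') into a threshold law in the scaling
variable B·T of LowTemperatureWeakAnharmonicity, and its V2 into a two-channel kinetic level
(RogisterOberman1968: Lenard–Balescu must be completed by a wave kinetic equation when weakly damped
modes exist) whose phonon channel is fast (velocity ∝ R in lattice units) — which is what the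
long-range heat-transport numerics show (flat bulk profiles, bath-to-bath transfer, size-dependent
conductance: IubiniEtAl2018, OlivaresAnteneodo2016; harmonic case AndreucciEtAl2023). Imported
areas: Vlasov/mean-field kinetic theory and Landau damping (PDE), Volterra renewal equations and the
half-line Paley–Wiener theorem (GripenbergLondenStaffans1990), period-function monotonicity for
planar Hamiltonian fields (Chicone1987). What it does that no open route of the sub does
(DrudeMourre, EscapeDeficit, FeketeResistance, FourierGreenKubo, LocalOhmRigidity,
NoiseHomotopyTransfer, SingleThermostatRigidity, SuperadditiveJunction all work at R = 1): it is the
one line in which 'thermal dephasing' is a checkable spectral statement, and it files both of its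
regimes; negatives index empty.

RANKED CRUXES. #0 PhononThresholdLaw (target) — X = X_gap ∧ X_emb: for all A, B > 0, every flow Φ of
q'' = −Aq − Bq³ (NewtonianFlow.IsFlow, N = 1) and every coupling s ∈ (0, A), with K_T(t) :=
−(d/dt)[∫ q₀ q_t e^(−h/T) / ∫ e^(−h/T)]/T the thermal dipole response kernel of the Duffing ensemble
(h = p²/2 + Aq²/2 + Bq⁴/4): (i) at SOME temperature T > 0, K_T ∈ L¹(0,∞) and the dispersion relation
has a root in the gap — ∃ ω ∈ (0, √A) with s∫₀^∞ K_T cos ωt dt = 1 and ∫₀^∞ K_T sin ωt dt = 0; (ii)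
there is T₁ such that at NO temperature T > T₁ does such a gap root exist. (why it might fail:
Inherits both cruxes: the edge susceptibility of the thermal Duffing ensemble might diverge (then no
threshold, phonon always in the gap or always embedded), K_T ∉ L¹, or an embedded real zero at a
harmonic threshold (2k+1)√A survives at high T.) [Louis1992, CampaEtAl2014,
BarreOlivettiYamaguchi2011, Defenu2021, RogisterOberman1968]
#2 GapPhononBranch (crux) — (card item K2, weak-twist side, corrected) for all A, B > 0, flows Φ of
the Duffing field and s ∈ (0, A) there is T₀ > 0 such that for every T ∈ (0, T₀): K_T is integrable
on (0, ∞) and the dispersion relation of the linearised lattice-Vlasov dipole sector at coupling s =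
φ̂(κ) has a root in the one-body spectral gap — ∃ ω ∈ (0, √A) with s ∫₀^∞ K_T(t) cos ωt dt = 1 and
∫₀^∞ K_T(t) sin ωt dt = 0: an UNDAMPED dressed phonon (discrete real eigenvalue below the band [√A,
∞) of one-body frequencies; harmonic check B = 0: K = sin(√A t)/√A, ω² = A − s). [deps:
DuffingTwist, DuffingFlow] [difficulty: L] (why it might fail: Rests on Duffing action–angle
asymptotics: m = 1 spectral weight ∝ I at the well bottom (so χ_T(√A⁻) ≈ 2A/(3BT) < ∞, → ∞ as T → 0)
and a t⁻² phase-mixing tail giving K_T ∈ L¹; a log correction to either, or higher odd harmonics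
misbehaving at low T, voids the root.) [Louis1992, CampaEtAl2014, Chicone1987,
BarreOlivettiYamaguchi2011, AndreucciEtAl2023, Defenu2021]
#3 EmbeddedRegimeDamping (crux) — (card item K2 in its true regime: linear Landau damping of the
dipole sector) for all A, B > 0, flows Φ and s ∈ (0, A) there is T₁ such that for every temperature
T > T₁: K_T ∈ L¹(0, ∞), and for all continuous S, m : ℝ → ℝ with S(t) → 0 and m(t) = S(t) + s ∫₀ᵗ
K_T(t − τ) m(τ) dτ for t ≥ 0 (the linearised lattice-Vlasov dipole dynamics at coupling s, S = the
freely phase-mixed source of the initial perturbation), m(t) → 0 as t → ∞. [deps: DuffingTwist,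
DuffingFlow] [difficulty: L] (why it might fail: Needs χ_T(edge) → 0 as T → ∞ (quartic scaling
suggests ~T^(−1/2), unproved), no real zero of 1 − sK̂_T on the continuum incl. the odd-harmonic
thresholds (2k+1)√A, none in the open half-plane (energy–Casimir stability for s < A), and K_T ∈ L¹
for the half-line Paley–Wiener theorem.) [GripenbergLondenStaffans1990, FaouRousset2015,
BarreOlivettiYamaguchi2011, CampaEtAl2014]
#9 DuffingTwist (support) — twist of the hardening well (the phase-mixing input of both cruxes; 'no
twist ⇒ no damping' is the harmonic chain): for A, B > 0 the half-period E ↦ ∫_{Aq²/2 + Bq⁴/4 < E}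
(2(E − Aq²/2 − Bq⁴/4))^(−1/2) dq is strictly decreasing on (0, ∞) (Chow–Wang 1986 for x'' + ax +
bx³; Chicone's criterion 1987). [difficulty: provable-now] [Chicone1987,
doi:10.21136/cpm.1986.118260]
#9 DuffingFlow (support) — non-vacuity of the ∀ Φ statements: for A, B > 0 the Duffing field q'' =
−Aq − Bq³ has a global flow in the sense of
Literature.MathematicalPhysics.KineticTheory.NewtonianFlow.IsFlow with N = 1 (energy conservation
confines orbits, the field is locally Lipschitz; cf. the cut-off construction of
FreeOscillatorFlow.lean for HairerMattingly2009 §2). [difficulty: provable-now]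
[HairerMattingly2009, Chicone1987]

TWO-LAYER PLAN. GapPhononBranch ⇐ EdgeSusceptibility (χ_T(√A⁻) finite with the 2A/(3BT)
low-temperature asymptotics) → KernelIntegrable (K_T ∈ L¹ from twist + linearly vanishing edge
weight, t⁻² tail) → GapPhononBranch (intermediate value theorem on (0, √A) from sχ_T(0) ≤ s/A < 1;
the sine part is the spectral density, zero in the gap). EmbeddedRegimeDamping ⇐ NoHalfPlaneZeros
(energy–Casimir stability + positivity of the m = 1 spectral density on (√A, ∞) + a high-temperature
bound on χ_T(edge)) → HalfLinePaleyWiener (resolvent in L¹ ⇒ decaying source gives decaying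
solution) → EmbeddedRegimeDamping. The three informal cruxes receive signatures by set-signature
once the two definition requests land (tenure), no split before that.

KILL CRITERIA. ¬GapPhononBranch (for some A, B, s no gap root at any small T — e.g. because χ_T
diverges at the edge and the dressed phonon is always embedded) restores the card's original V1 and
kills THIS thesis: close refuted:GapPhononBranch and let the tenure planner reopen along the
uncorrected card. ¬EmbeddedRegimeDamping through an embedded real zero at high T (an undamped mode
inside the continuum) kills the 'Landau damping = dephasing theorem' half for good: pivot to a pure
gap-mode / ballistic-channel line (restate the target to clause (i) plus the scaling item).
Certified numerics showing κ_latt(R)/R convergent at LOW temperature for the Kac chain (the card's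
falsifier (a) contradicting the R² channel) force a rethink of TwoChannelKineticLimit /
KacConductivityScaling, not of X. A proof of FouriersLaw elsewhere moots the rung but not its
statements.

NOT DECOMPOSED YET. β > 0 (quartic Kac coupling): the odd sector becomes rank 2 (moments ∫q g and
∫q³ g, force profiles 1 + 3β⟨q²⟩-shifted and q²-weighted) and the dispersion function a 2×2
determinant with the same edge behaviour — a layer-2 restatement, not filed now. The exact threshold
T*(A, B, s) (conjecturally unique: sχ_T(edge) strictly decreasing in T), uniqueness/simplicity of
the gap root and its low-T expansion ω(κ)² = A − s + O(BT). Nonlinear Landau damping of gap modes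
(second-harmonic resonance 2ω(κ) ∈ [√A, ∞) iff s ≤ 3A/4) and their O(1/R) collisional lifetime.
Everything at the N-particle level (V0, kinetic level, conductivity scaling) stays informal until
KacOscillatorChain / LatticeVlasovEquation land; the long-time (τ → ∞) Lenard–Balescu wall is shared
with every kinetic card of the sub and is not split here.

CHEAPEST FALSIFIER. One afternoon of quadrature (kit): for A = 1, B = 1, s = 0.5 compute χ_T(ω) =
∫₀^∞ K_T(t) cos ωt dt from Duffing action–angle data (or a 10⁴-trajectory thermal average of
q(0)q(t)) at T ∈ {0.05, 0.2, 1, 5}; the route predicts sχ_T(√A⁻) > 1 with a gap root near ω² ≈ A − s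
at the two low temperatures and sχ_T(√A⁻) < 1 at the two high ones — no sign change across this
range kills PhononThresholdLaw as a useful dichotomy. Model level: the card's equilibrium MD of the
Kac chain (R ∈ {2, 4, 8, 16}, N = 64R, (ω₂, lam, β, T) = (1, 1, 1, 1)): this route predicts κ(R)
growing like R² with a sharp phonon line just below √A_T in the current spectrum, and κ(R) ∝ R only
at high temperature. Neither was run here (plancard seat; no kit job submitted).

NUMBERS. Band edge Ω_T(0) = √A with A = ω₂ + Φ₀ (β = 0 sector), Φ₀ = ∫φ; bare Kac phonon ω(κ)² = A −
φ̂(κ) ∈ [ω₂, A); edge susceptibility χ_T(√A⁻) = (2A/(3BT))·(1 + o(1)) as BT/A² → 0 from the m = 1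
term (higher odd harmonics add positive amounts; even ones vanish by q(θ + π) = −q(θ)); gap-mode
threshold φ̂(κ)·χ_T(edge) = 1, i.e. T*(κ) ≈ 2Aφ̂(κ)/(3B) to leading order; static bound sχ_T(0) =
s⟨q²⟩_T/T ≤ s/A < 1 (BrascampLieb1976), so no zero-frequency instability and m_T = 0 is the unique
Hartree state for ω₂ > 0. Card falsifier point (ω₂, lam, β, T) = (1, 1, 1, 1) with Φ₀ ≈ 2.5: A ≈
4.6, B ≈ 3.5, χ_edge ≈ 0.9, φ̂(0)χ_edge ≈ 2 > 1 — gap regime for long waves (leading-order estimate,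
BT/A² ≈ 0.17). Items: 6 typed at open (2 cruxes, 2 supports, target, assembly) + 3 informal cruxes
(ranks 4–6) + 2 definition requests filed right after open; cruxes total 5.

DEFINITION REQUESTS. KacOscillatorChain (topic Literature/MathematicalPhysics/KineticTheory, next to
FouriersLaw.lean; CampaEtAl2014 §8.5, BachelardEtAl2011): chain data (U, V, γ, kernel φ, range R),
the Hamiltonian with the Kac-normalised pair sum ½Σ_{x≠y} R⁻¹φ((x−y)/R)V(q_x − q_y), the Langevin
generator with the same two end baths as OscillatorChain.generator, the energy flux through a cut,
IsSteadyState and the BLR predicate FouriersLawFor, with 'range 1 = pinnedChain' as a lemma target.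
LatticeVlasovEquation (same topic): weak solutions f(u, q, p, t) on [0, L] × ℝ² of ∂_t f + p∂_q f −
∂_q[U + W_f]∂_p f = 0 with W_f(u, q) = ∫φ(u − u′)∫V(q − q′) f(u′, q′, p′), thermal (Hartree) states
and the linearised operator. Both are wanted by the informal cruxes LatticeVlasovLimit /
TwoChannelKineticLimit / KacConductivityScaling and are filed with `ledger workitem add --kind
definition` right after open. No cite facts are requested: nothing in the typed layer uses a named
fact.

Novelty: Searches (2026-08-15, this seat): `lit search --source crossref` ×9 ("existence of oscillation modes
collisionless … Mathur/Louis" → Louis1992 doi:10.1093/mnras/258.3.552; "Defenu metastability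
discrete spectrum" → Defenu2021; "Rogister Oberman weakly unstable plasma" → RogisterOberman1968;
"Barré Olivetti Yamaguchi algebraic damping" → BarreOlivettiYamaguchi2011 +
doi:10.1088/1751-8113/46/22/225501 + doi:10.1016/j.crhy.2015.03.013; "monotonicity period function
Duffing Chicone" → Chicone1987, doi:10.21136/cpm.1986.118260; "heat transport oscillator chains
long-range … Iubini" → IubiniEtAl2018 (+ doi:10.1088/1751-8121/ab22f7); "nonequilibrium steady
states long-range coupled harmonic chains" → AndreucciEtAl2023,
doi:10.21468/scipostphyscore.5.3.036, doi:10.1007/s10955-024-03383-9); `lit search --hybrid --source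
local` "Landau damping inhomogeneous stationary states Vlasov HMF collective modes discrete
spectrum" (10 held docs; CampaEtAl2014 read at PDF pp. 197–199: 1-D Lenard–Balescu cancellation,
water-bag real dielectric zeros); `lit frontier AtomisticToContinuum --since 2020` (30 rows, none on
long-range chains or Vlasov limits of lattices); `lit bridges AtomisticToContinuum --cross any`
(none relevant); `lit galaxy search --star all "Landau damping in the mean-field phi4 model"`
(galaxyd queue timeout, 0 rows); openalex 429 (budget exhausted); plus the card's own vsearch/galaxy
log and its refuter audit (BachelardEtAl2011, Heyvaerts2010, Chavanis2012 as uncited priors); `l  [refs: 10.1093/mnras/258.3.552, 10.1088/1751-8113/46/22/225501, 10.1016/j.crhy.2015.03.013, 10.21136/cpm.1986.118260, 10.1088/1751-8121/ab22f7, 10.21468/scipostphyscore.5.3.036, 10.1007/s10955-024-03383-9, doi:10.1093/mnras/258.3.552, doi:10.1088/1751-8113/46/22/225501, doi:10.1016/j.crhy.2015.03.013, doi:10.21136/cpm.1986.118260, doi:10.1088/1751-8121/ab22f7, doi:10.21468/scipostphyscore.5.3.036, doi:10]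

Barriers (technique_class: kac-range lattice-vlasov landau-damping lenard-balescu): - technique_class: kac-range lattice-vlasov landau-damping lenard-balescu
- Literature.Barriers.AtomisticToContinuum.HarmonicChainBallisticFlux: not evaded but LOCATED — at R
= ∞ the ballistic harmonic phonon survives twist as a discrete gap eigenvalue exactly when
φ̂(κ)χ_T(edge) > 1 (GapPhononBranch) and dissolves into the Landau-damped continuum above the
threshold (EmbeddedRegimeDamping); B = 0 gives K = sin(√A t)/√A ∉ L¹ and the bare phonon ω² = A − s,
so no statement of the route is anharmonicity-free and both cruxes are stated for B > 0 only.
- Literature.Barriers.AtomisticToContinuum.LowTemperatureWeakAnharmonicity: the threshold is a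
function of B·T, the barrier's own scaling variable; the route CONCEDES the low-temperature corner
to the undamped-phonon regime instead of claiming temperature-uniform damping, and nothing in it is
perturbative-uniform in (lam, β) at (0, 0).
- Literature.Barriers.AtomisticToContinuum.Mazur1969_inequality: consistent and used as a check —
below threshold the gap phonons are a genuine ballistic channel at Vlasov order (positive Drude
weight at R = ∞), which is precisely why the card's 'the dephased state is frozen, dephasing
transports nothing' needed the correction; at every finite R collisions give them a lifetime ∝ R
(informal TwoChannelKineticLimit), removing the Drude weight.
- Literature.Barriers.AtomisticToContinuum.MacroErgodicityBarrier: untouched by the typed layer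
(one-body linear spectral theory); the informal kinetic items tak

History (route lifecycle, newest last):
- 2026-08-15T13:43:27Z · CLOSED retired — not-a-thesis: assembly does not conclude the sub-problem Statement (operator:999:1257524)

sub-problem: FouriersLaw · status: closed(retired) · opened planner-plancard-AtomisticToContinuum-Fourier-08915f5e-0 2026-08-15T11:41:38Z · rev 0 · ledger route-AtomisticToContinuum-KacRangeDichotomy
GENERATED by the gate from the ledger (D-0016/17). Provers cite these decls: `theorem foo : Summit.AtomisticToContinuum.FouriersLaw.Theses.KacRangeDichotomy.<Decl> := …` in Summits/AtomisticToContinuum/FouriersLaw/Theorems/<Name>.lean.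
-/

namespace Summit.AtomisticToContinuum.FouriersLaw.Theses.KacRangeDichotomy

open scoped BigOperators Topology Manifold Classical MeasureTheory ProbabilityTheory Matrix InnerProductSpace ComplexConjugate ContinuousMap
open Filter Set Function TopologicalSpace MeasureTheory

attribute [summit_statement] _root_.FouriersLaw

/-- item stmt-AtomisticToContinuum-5573 · target · rank 0 · closed · moot by None · by planner
why it might fail: Inherits both cruxes: the edge susceptibility of the thermal Duffing ensemble might diverge (then no threshold, phonon always in the gap or always embedded), K_T ∉ L¹, or an embedded real zero at a harmonic threshold (2k+1)√A survives at high T.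
sources: Louis1992, CampaEtAl2014, BarreOlivettiYamaguchi2011, Defenu2021, RogisterOberman1968
[target] X = X_gap ∧ X_emb: for all A, B > 0, every flow Φ of q'' = −Aq − Bq³ (NewtonianFlow.IsFlow,
N = 1) and every coupling s ∈ (0, A), with K_T(t) := −(d/dt)[∫ q₀ q_t e^(−h/T) / ∫ e^(−h/T)]/T the
thermal dipole response kernel of the Duffing ensemble (h = p²/2 + Aq²/2 + Bq⁴/4): (i) at SOME
temperature T > 0, K_T ∈ L¹(0,∞) and the dispersion relation has a root in the gap — ∃ ω ∈ (0, √A)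
with s∫₀^∞ K_T cos ωt dt = 1 and ∫₀^∞ K_T sin ωt dt = 0; (ii) there is T₁ such that at NO
temperature T > T₁ does such a gap root exist. -/
@[route_item "route-AtomisticToContinuum-KacRangeDichotomy"]
def PhononThresholdLaw : Prop :=
  ∀ A B : ℝ, 0 < A → 0 < B → ∀ Φ : ℝ → Literature.MathematicalPhysics.KineticTheory.HeatConduction.PhaseSpace 1 → Literature.MathematicalPhysics.KineticTheory.HeatConduction.PhaseSpace 1, Literature.MathematicalPhysics.KineticTheory.NewtonianFlow.IsFlow (fun q : Fin 1 → ℝ => fun _ : Fin 1 => -(A * q 0 + B * q 0 ^ 3)) Φ → let K : ℝ → ℝ → ℝ := fun T t => -(deriv (fun t' : ℝ => (∫ z : Literature.MathematicalPhysics.KineticTheory.HeatConduction.PhaseSpace 1, z.1 0 * (Φ t' z).1 0 * Real.exp (-(((z.2 0) ^ 2 / 2 + A * (z.1 0) ^ 2 / 2 + B * (z.1 0) ^ 4 / 4) / T))) / (∫ z : Literature.MathematicalPhysics.KineticTheory.HeatConduction.PhaseSpace 1, Real.exp (-(((z.2 0) ^ 2 / 2 + A * (z.1 0) ^ 2 /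 2 + B * (z.1 0) ^ 4 / 4) / T)))) t) / T; ∀ s : ℝ, 0 < s → s < A → (∃ T : ℝ, 0 < T ∧ MeasureTheory.IntegrableOn (K T) (Set.Ioi 0) ∧ ∃ ω : ℝ, 0 < ω ∧ ω < Real.sqrt A ∧ s * (∫ t in Set.Ioi (0 : ℝ), K T t * Real.cos (ω * t)) = 1 ∧ (∫ t in Set.Ioi (0 : ℝ), K T t * Real.sin (ω * t)) = 0) ∧ ∃ T₁ : ℝ, ∀ T : ℝ, 0 < T → T₁ < T → ∀ ω : ℝ, 0 < ω → ω < Real.sqrt A → ¬ (s * (∫ t in Set.Ioi (0 : ℝ), K T t * Real.cos (ω * t)) = 1 ∧ (∫ t in Set.Ioi (0 : ℝ), K T t * Real.sin (ω * t)) = 0)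

/-- item stmt-AtomisticToContinuum-5574 · crux · rank 2 · closed · moot by None · by planner
why it might fail: Rests on Duffing action–angle asymptotics: m = 1 spectral weight ∝ I at the well bottom (so χ_T(√A⁻) ≈ 2A/(3BT) < ∞, → ∞ as T → 0) and a t⁻² phase-mixing tail giving K_T ∈ L¹; a log correction to either, or higher odd harmonics misbehaving at low T, voids the root.
sources: Louis1992, CampaEtAl2014, Chicone1987, BarreOlivettiYamaguchi2011, AndreucciEtAl2023, Defenu2021
[crux] (card item K2, weak-twist side, corrected) for all A, B > 0, flows Φ of the Duffing field and
s ∈ (0, A) there is T₀ > 0 such that for every T ∈ (0, T₀): K_T is integrable on (0, ∞) and the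
dispersion relation of the linearised lattice-Vlasov dipole sector at coupling s = φ̂(κ) has a root
in the one-body spectral gap — ∃ ω ∈ (0, √A) with s ∫₀^∞ K_T(t) cos ωt dt = 1 and ∫₀^∞ K_T(t) sin ωt
dt = 0: an UNDAMPED dressed phonon (discrete real eigenvalue below the band [√A, ∞) of one-body
frequencies; harmonic check B = 0: K = sin(√A t)/√A, ω² = A − s). [deps: DuffingTwist, DuffingFlow]
[difficulty: L] -/
@[route_item "route-AtomisticToContinuum-KacRangeDichotomy"]
def GapPhononBranch : Prop :=
  ∀ A B : ℝ, 0 < A → 0 < B → ∀ Φ : ℝ → Literature.MathematicalPhysics.KineticTheory.HeatConduction.PhaseSpace 1 → Literature.MathematicalPhysics.KineticTheory.HeatConduction.PhaseSpace 1, Literature.MathematicalPhysics.KineticTheory.NewtonianFlow.IsFlow (fun q : Fin 1 → ℝ => fun _ : Fin 1 => -(A * q 0 + B * q 0 ^ 3)) Φ → let K : ℝ → ℝ → ℝ := fun T t => -(deriv (fun t' : ℝ => (∫ z : Literature.MathematicalPhysics.KineticTheory.HeatConduction.PhaseSpace 1, z.1 0 * (Φ t' z).1 0 * Real.exp (-(((z.2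 0) ^ 2 / 2 + A * (z.1 0) ^ 2 / 2 + B * (z.1 0) ^ 4 / 4) / T))) / (∫ z : Literature.MathematicalPhysics.KineticTheory.HeatConduction.PhaseSpace 1, Real.exp (-(((z.2 0) ^ 2 / 2 + A * (z.1 0) ^ 2 / 2 + B * (z.1 0) ^ 4 / 4) / T)))) t) / T; ∀ s : ℝ, 0 < s → s < A → ∃ T₀ : ℝ, 0 < T₀ ∧ ∀ T : ℝ, 0 < T → T < T₀ → MeasureTheory.IntegrableOn (K T) (Set.Ioi 0) ∧ ∃ ω : ℝ, 0 < ω ∧ ω < Real.sqrt A ∧ s * (∫ t in Set.Ioi (0 : ℝ), K T t * Real.cos (ω * t)) = 1 ∧ (∫ t in Set.Ioi (0 : ℝ), K T t * Real.sin (ω * t)) = 0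

/-- item stmt-AtomisticToContinuum-5575 · crux · rank 3 · closed · moot by None · by planner
why it might fail: Needs χ_T(edge) → 0 as T → ∞ (quartic scaling suggests ~T^(−1/2), unproved), no real zero of 1 − sK̂_T on the continuum incl. the odd-harmonic thresholds (2k+1)√A, none in the open half-plane (energy–Casimir stability for s < A), and K_T ∈ L¹ for the half-line Paley–Wiener theorem.
sources: GripenbergLondenStaffans1990, FaouRousset2015, BarreOlivettiYamaguchi2011, CampaEtAl2014
[crux] (card item K2 in its true regime: linear Landau damping of the dipole sector) for all A, B >
0, flows Φ and s ∈ (0, A) there is T₁ such that for every temperature T > T₁: K_T ∈ L¹(0, ∞), and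
for all continuous S, m : ℝ → ℝ with S(t) → 0 and m(t) = S(t) + s ∫₀ᵗ K_T(t − τ) m(τ) dτ for t ≥ 0
(the linearised lattice-Vlasov dipole dynamics at coupling s, S = the freely phase-mixed source of
the initial perturbation), m(t) → 0 as t → ∞. [deps: DuffingTwist, DuffingFlow] [difficulty: L] -/
@[route_item "route-AtomisticToContinuum-KacRangeDichotomy"]
def EmbeddedRegimeDamping : Prop :=
  ∀ A B : ℝ, 0 < A → 0 < B → ∀ Φ : ℝ → Literature.MathematicalPhysics.KineticTheory.HeatConduction.PhaseSpace 1 → Literature.MathematicalPhysics.KineticTheory.HeatConduction.PhaseSpace 1, Literature.MathematicalPhysics.KineticTheory.NewtonianFlow.IsFlow (fun q : Fin 1 → ℝ => fun _ : Fin 1 => -(A * q 0 + B * q 0 ^ 3)) Φ → let K : ℝ → ℝ → ℝ := fun T t => -(deriv (fun t' : ℝ => (∫ z : Literature.MathematicalPhysics.KineticTheory.HeatConduction.PhaseSpace 1, z.1 0 * (Φ t' z).1 0 * Real.exp (-(((z.2 0) ^ 2 / 2 + A * (z.1 0) ^ 2 / 2 + B * (z.1 0) ^ 4 / 4) / T)))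 / (∫ z : Literature.MathematicalPhysics.KineticTheory.HeatConduction.PhaseSpace 1, Real.exp (-(((z.2 0) ^ 2 / 2 + A * (z.1 0) ^ 2 / 2 + B * (z.1 0) ^ 4 / 4) / T)))) t) / T; ∀ s : ℝ, 0 < s → s < A → ∃ T₁ : ℝ, ∀ T : ℝ, 0 < T → T₁ < T → MeasureTheory.IntegrableOn (K T) (Set.Ioi 0) ∧ ∀ S m : ℝ → ℝ, Continuous S → Continuous m → Filter.Tendsto S Filter.atTop (nhds 0) → (∀ t : ℝ, 0 ≤ t → m t = S t + s * ∫ τ in (0 : ℝ)..t, K T (t - τ) * m τ) → Filter.Tendsto m Filter.atTop (nhds 0)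

-- item stmt-AtomisticToContinuum-6763 · support · rank 4 · closed · moot by None · by planner — informal only, no Lean statement yet:
--   [crux] LATTICE VLASOV LIMIT (card rung V0; signature awaits the definition requests
--   KacOscillatorChain and LatticeVlasovEquation). For the Kac chain H_R = Σ_x [p_x²/2 + U(q_x)] + ½
--   Σ_{x≠y} R⁻¹φ((x−y)/R) V(q_x − q_y) (U = ω₂q²/2 + lam q⁴/4, V = r²/2 + βr⁴/4, ω₂ > 0, lam, β ≥ 0 not
--   both harmonic; φ ≥ 0 even, C², compact support, φ(±1) = 1 and φ = 0 at the integers |z| ≥ 2 so that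
--   R = 1 is pinnedChain), N = LR sites, deterministic bulk dynamics (the two Langevin end baths touch 2
--   of LR sites and are invisible at this order on times O(1)), initial data independent across sites
--   with a C¹ profile of

-- item stmt-AtomisticToContinuum-6790 · support · rank 5 · closed · moot by None · by planner — informal only, no Lean statement yet:
--   [crux] ORDER-1/R KINETIC LEVEL WITH TWO CHANNELS (card rung V2 corrected by GapPhononBranch;
--   signature awaits KacOscillatorChain / LatticeVlasovEquation). On times t = Rτ, for the Kac chain (as
--   in LatticeVlasovLimit) started from f_T-chaotic data with a slowly varying (in u) temperature/action
--   profile: (i) EMBEDDED REGIME (T above the gap threshold of every macroscopic wavenumber, i.e. sup_κ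
--   φ̂(κ)·χ_T(√A⁻) < 1 in the notation of EmbeddedRegimeDamping): the one-body action distribution F(u,
--   I, τ) converges to the solution of the inhomogeneous (angle–action) Lenard–Balescu equation with
--   cross-ha

-- item stmt-AtomisticToContinuum-6805 · support · rank 6 · closed · moot by None · by planner — informal only, no Lean statement yet:
--   [crux] CONDUCTIVITY OF THE KAC CHAIN — WINDOW FOURIER LAW AND THE R VERSUS R² DICHOTOMY (top of the
--   rung; replaces the card's 'κ_micro ≍ R·κ_macro'; signature awaits KacOscillatorChain, then it is the
--   FouriersLawFor-analogue plus two limit clauses). For the Kac chain of LatticeVlasovLimit with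
--   Langevin baths (friction γ, temperatures T ± δ/2) at sites 0 and N−1, in the
--   Bonetto–Lebowitz–Rey-Bellet order of limits (δ → 0 at fixed N, then N → ∞), with D_N(T; R) :=
--   lim_{δ→0} (Σ over the N−1 cuts of the steady energy flux through the cut)/δ: (a) for every R ≥ R₀(T)
--   the weak steady state exists and

/-- item stmt-AtomisticToContinuum-5576 · support · rank 9 · closed · moot by None · by planner
sources: Chicone1987, doi:10.21136/cpm.1986.118260
[support] twist of the hardening well (the phase-mixing input of both cruxes; 'no twist ⇒ no
damping' is the harmonic chain): for A, B > 0 the half-period E ↦ ∫_{Aq²/2 + Bq⁴/4 < E} (2(E − Aq²/2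
− Bq⁴/4))^(−1/2) dq is strictly decreasing on (0, ∞) (Chow–Wang 1986 for x'' + ax + bx³; Chicone's
criterion 1987). [difficulty: provable-now] -/
@[route_item "route-AtomisticToContinuum-KacRangeDichotomy"]
def DuffingTwist : Prop :=
  ∀ A B : ℝ, 0 < A → 0 < B → StrictAntiOn (fun E : ℝ => ∫ q in {q : ℝ | A * q ^ 2 / 2 + B * q ^ 4 / 4 < E}, (Real.sqrt (2 * (E - (A * q ^ 2 / 2 + B * q ^ 4 / 4))))⁻¹) (Set.Ioi 0)

/-- item stmt-AtomisticToContinuum-5577 · support · rank 9 · closed · moot by None · by planner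
sources: HairerMattingly2009, Chicone1987
[support] non-vacuity of the ∀ Φ statements: for A, B > 0 the Duffing field q'' = −Aq − Bq³ has a
global flow in the sense of Literature.MathematicalPhysics.KineticTheory.NewtonianFlow.IsFlow with N
= 1 (energy conservation confines orbits, the field is locally Lipschitz; cf. the cut-off
construction of FreeOscillatorFlow.lean for HairerMattingly2009 §2). [difficulty: provable-now] -/
@[route_item "route-AtomisticToContinuum-KacRangeDichotomy"]
def DuffingFlow : Prop :=
  ∀ A B : ℝ, 0 < A → 0 < B → ∃ Φ : ℝ → Literature.MathematicalPhysics.KineticTheory.HeatConduction.PhaseSpace 1 → Literature.MathematicalPhysics.KineticTheory.HeatConduction.PhaseSpace 1, Literature.MathematicalPhysics.KineticTheory.NewtonianFlow.IsFlow (fun q : Fin 1 → ℝ => fun _ : Fin 1 => -(A * q 0 + B * q 0 ^ 3)) Φ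

/-- item stmt-AtomisticToContinuum-5578 · assembly · rank 1 · closed · moot by None · by planner
sources: GripenbergLondenStaffans1990, Louis1992
[assembly] GapPhononBranch → EmbeddedRegimeDamping → PhononThresholdLaw (route-local target; rung
route). -/
@[route_item "route-AtomisticToContinuum-KacRangeDichotomy"]
def Assembly : Prop :=
  GapPhononBranch → EmbeddedRegimeDamping → PhononThresholdLaw

end Summit.AtomisticToContinuum.FouriersLaw.Theses.KacRangeDichotomy
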